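import Summits.KontsevichZagierPeriods.KontsevichZagierPeriods.Theses.RealPeriodGerms
import Literature.ModelTheory.ExponentialFields.SemialgebraicInterior

/-!
# `GenericNeighbourhood` (stmt-KontsevichZagierPeriods-3846, route RealPeriodGerms) — proof

Statement: for a `ℚ`-semialgebraic set `A ⊆ ℝ ^ N` and a point `p ∈ A` there is a neighbourhood
`U` of `p` such that every `z ∈ U` satisfying all the `ℚ`-polynomial equations satisfied by `p`
(i.e. `z` in the real points `Loc(p)` of the `ℚ`-Zariski closure of `p`) lies in `A`: a
`ℚ`-semialgebraic set containing `p` contains a neighbourhood of `p` inside `Loc(p)`.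

Proof: induction over the generating Boolean combinations (`BooleanSubalgebra.closure_bot_sup_induction`
on the definition of `Literature.ModelTheory.ExponentialFields.IsSemialgebraic`) of the TWO-SIDED
strengthening "there is a neighbourhood `U` of `p` on which membership in `s` is constant along
`Loc(p)`, equal to that of `p`" (`z ∈ s ↔ p ∈ s`). This is stable under complement (negate both
sides), under binary union (intersect the two neighbourhoods) and holds for `∅`; for the generators
one argues by cases on the sign of `q(p)`: on the zero set `{q = 0}`, if `q(p) = 0` every point of
`Loc(p)` satisfies `q = 0` (take `U = univ`), otherwise `{q ≠ 0}` is an open neighbourhood of `p`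
missing the zero set; on the positivity set `{q > 0}`, the open sets `{q > 0}`, `{q < 0}` settle the
cases `q(p) > 0`, `q(p) < 0`, and if `q(p) = 0` then neither `p` nor any point of `Loc(p)` lies in
`{q > 0}`. Specialising the two-sided statement at `p ∈ A` gives the item.
-/

open Set Filter MvPolynomial
open scoped Topology

namespace Summit.KontsevichZagierPeriods.RealPeriodGerms

/-- **Two-sided genericity along the `ℚ`-locus.** For a `ℚ`-semialgebraic `s ⊆ ℝ ^ N` and any
point `p`, there is a neighbourhood `U` of `p` such that every `z ∈ U` satisfying all the
`ℚ`-polynomial equations of `p` lies in `s` iff `p` does: the germ at `p` of `Loc(p)` is contained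
in `s` or in `sᶜ`. Induction over the Boolean algebra generated by zero sets and positivity sets of
polynomials over `ℚ`, by cases on the sign of the generating polynomial at `p`. [folklore]
[cite: BochnakCosteRoy1998, Def. 2.1.4] -/
theorem exists_nhds_mem_iff_of_isSemialgebraic {N : ℕ} {s : Set (Fin N → ℝ)}
    (hs : Literature.ModelTheory.ExponentialFields.IsSemialgebraic ℚ s) (p : Fin N → ℝ) :
    ∃ U ∈ 𝓝 p, ∀ z ∈ U, (∀ q : MvPolynomial (Fin N) ℚ, aeval p q = 0 → aeval z q = 0) →
      (z ∈ s ↔ p ∈ s) := by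
  induction hs using BooleanSubalgebra.closure_bot_sup_induction with
  | mem s hs =>
    rcases hs with ⟨q, rfl⟩ | ⟨q, rfl⟩
    · -- zero set `{x | q(x) = 0}`
      by_cases hq : aeval p q = 0
      · exact ⟨univ, univ_mem, fun z _ hz => iff_of_true (hz q hq) hq⟩
      · exact ⟨{x | aeval x q ≠ 0},
          (isOpen_ne_fun (Literature.ModelTheory.ExponentialFields.continuous_aeval_real q)
            continuous_const).mem_nhds hq,
          fun z hz _ => iff_of_false hz hq⟩
    · -- strict positivity set `{x | 0 < q(x)}`
      rcases lt_trichotomy (aeval p q) 0 with hlt | heq | hgt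
      · refine ⟨{x | aeval x q < 0},
          (isOpen_lt (Literature.ModelTheory.ExponentialFields.continuous_aeval_real q)
            continuous_const).mem_nhds hlt,
          fun z hz _ => iff_of_false ?_ (not_lt.2 hlt.le)⟩
        have hz' : aeval z q < 0 := hz
        show ¬ (0 < aeval z q)
        exact not_lt.2 hz'.le
      · refine ⟨univ, univ_mem, fun z _ hz => iff_of_false ?_ ?_⟩
        · show ¬ (0 < aeval z q)
          rw [hz q heq]
          exact lt_irrefl 0
        · show ¬ (0 < aeval p q)
          rw [heq]
          exact lt_irrefl 0
      · exact ⟨{x | 0 < aeval x q},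
          (isOpen_lt continuous_const
            (Literature.ModelTheory.ExponentialFields.continuous_aeval_real q)).mem_nhds hgt,
          fun z hz _ => iff_of_true hz hgt⟩
  | bot => exact ⟨univ, univ_mem, fun z _ _ => by simp⟩
  | sup s _ t _ ihs iht =>
    obtain ⟨U, hU, hUs⟩ := ihs
    obtain ⟨V, hV, hVt⟩ := iht
    refine ⟨U ∩ V, inter_mem hU hV, fun z hz hpz => ?_⟩
    show z ∈ s ∪ t ↔ p ∈ s ∪ t
    rw [mem_union, mem_union, hUs z hz.1 hpz, hVt z hz.2 hpz]
  | compl s _ ih =>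
    obtain ⟨U, hU, hUs⟩ := ih
    refine ⟨U, hU, fun z hz hpz => ?_⟩
    rw [mem_compl_iff, mem_compl_iff, hUs z hz hpz]

/-- **`GenericNeighbourhood`** (route RealPeriodGerms, stmt-KontsevichZagierPeriods-3846): a
`ℚ`-semialgebraic subset `A ⊆ ℝ ^ N` containing `p` contains `U ∩ Loc(p)` for some neighbourhood
`U` of `p`, where `Loc(p) = {z | every ℚ-polynomial vanishing at p vanishes at z}`. Specialise the
two-sided genericity statement `exists_nhds_mem_iff_of_isSemialgebraic` at the point `p ∈ A`.
[folklore] -/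
theorem genericNeighbourhood_proof :
    Summit.KontsevichZagierPeriods.KontsevichZagierPeriods.Theses.RealPeriodGerms.GenericNeighbourhood := by
  intro N p A hA hp
  obtain ⟨U, hU, h⟩ := exists_nhds_mem_iff_of_isSemialgebraic hA p
  exact ⟨U, hU, fun z hz hpz => (h z hz hpz).2 hp⟩

end Summit.KontsevichZagierPeriods.RealPeriodGerms
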